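import Mathlib
import Summits.Ventures.HodgeRepro2.T5ProfiniteDistributionMeasure

/-!
# T5ProfiniteDistributionLimit — `{bounded measures on X} ≅ lim_k A[F k]` as `A`-modules, for a
presented profinite space `X`: «`W[[Γ]] = lim_U W[Γ/U]`» as the module isomorphism of the model

Tier-5 support for route-3's §G (route/T5-CHECK-G-p7.md §3 S1 / S2 / S4 / S5, §20.2, §21.4):
T5IwasawaLimit packaged the dictionary on `Γ_𝔭 ≅ ℤ_p` as an additive equivalence
`BoundedMeasure p A ≃+ iwasawaLimit p A`; this file packages it for ANY presented profinite space
(`Γ⁻ ≅ ℤ_p^δ` with its levels `(ℤ/p^k)^δ` included) and as `A`-MODULES: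

* `IsCompat P v` — the inverse-limit condition on a system `v k : F k → A`;
* `limitSubmodule P A : Submodule A (∀ k, F k → A)` — the bounded compatible systems, the bounded
  part of `lim_k A[F k]` (`W[[Γ]]` as printed: over a DVR with valuation norm every compatible
  system is bounded, `mem_limitSubmodule_iff_of_normDict`, so the bounded part is everything);
* `boundedMeasures X A : Submodule A (C(X, A) →ₗ[A] A)` — the bounded `A`-linear functionals;
* `coordLinear P A : boundedMeasures X A →ₗ[A] limitSubmodule P A` — `m ↦ (coord m k)_k`,
  `A`-linear, INJECTIVE (T5ProfiniteDistribution) and SURJECTIVE (T5ProfiniteDistributionMeasure);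
* **`coordLinearEquiv P A : boundedMeasures X A ≃ₗ[A] limitSubmodule P A`** — the dictionary
  «a bounded `W`-valued measure on `Γ` IS an element of `lim_U W[Γ/U]`», as `W`-modules, for any
  complete ultrametric `A` and any presented `X`.

No printed input is consumed.  §8(d): uses an L-value-free non-vanishing device: NO.
-/

namespace Summit.Ventures.HodgeRepro2.T5ProfiniteDistributionLimit

open Summit.Ventures.HodgeRepro2.T5ProfiniteDistribution
open Summit.Ventures.HodgeRepro2.T5ProfiniteDistributionMeasure
open Finset

universe u v

variable {X : Type u} [MetricSpace X] (P : Presentation.{u, v} X) (A : Type*) [NormedCommRing A]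

section Compat

/-- The inverse-limit condition on a system of functions on the levels. -/
def IsCompat (v : ∀ k : ℕ, P.F k → A) : Prop :=
  ∀ (k : ℕ) (a : P.F k), v k a = ∑ b ∈ univ.filter (fun b : P.F (k + 1) => P.res k b = a), v (k + 1) b

variable {P A}

/-- The zero system is compatible. -/
theorem IsCompat.zero : IsCompat P A 0 := fun _ _ => by simp

/-- Compatible systems are closed under addition. -/
theorem IsCompat.add {v w : ∀ k : ℕ, P.F k → A} (hv : IsCompat P A v) (hw : IsCompat P A w) :
    IsCompat P A (v + w) := fun k a => by
  simp only [Pi.add_apply, hv k a, hw k a, Finset.sum_add_distrib]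

/-- Compatible systems are closed under negation. -/
theorem IsCompat.neg {v : ∀ k : ℕ, P.F k → A} (hv : IsCompat P A v) : IsCompat P A (-v) :=
  fun k a => by simp only [Pi.neg_apply, hv k a, Finset.sum_neg_distrib]

/-- Compatible systems are closed under scalar multiplication. -/
theorem IsCompat.smul {v : ∀ k : ℕ, P.F k → A} (hv : IsCompat P A v) (c : A) :
    IsCompat P A (c • v) := fun k a => by
  simp only [Pi.smul_apply, smul_eq_mul, hv k a, Finset.mul_sum]

/-- The values of a distribution form a compatible system. -/
theorem Distribution.isCompat_val (d : Distribution P A) : IsCompat P A d.val := d.compat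

/-- The coordinates of a measure form a compatible system. -/
theorem isCompat_coord (m : C(X, A) →ₗ[A] A) : IsCompat P A (P.coord m) := P.coord_compat m

variable (P A)

/-- THE BOUNDED PART OF `lim_k A[F k]`: the compatible systems with a uniform bound, as an
`A`-submodule of `∀ k, F k → A` (`W[[Γ]]` as printed, read level by level). -/
def limitSubmodule : Submodule A (∀ k : ℕ, P.F k → A) where
  carrier := {v | IsCompat P A v ∧ ∃ C : ℝ, ∀ (k : ℕ) (a : P.F k), ‖v k a‖ ≤ C}
  zero_mem' := ⟨IsCompat.zero, 0, fun k a => by simp⟩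
  add_mem' := by
    rintro v w ⟨hv, C, hC⟩ ⟨hw, D, hD⟩
    exact ⟨hv.add hw, C + D, fun k a =>
      (norm_add_le _ _).trans (add_le_add (hC k a) (hD k a))⟩
  smul_mem' := by
    rintro c v ⟨hv, C, hC⟩
    refine ⟨hv.smul c, ‖c‖ * C, fun k a => ?_⟩
    simp only [Pi.smul_apply, smul_eq_mul]
    exact (norm_mul_le _ _).trans (mul_le_mul_of_nonneg_left (hC k a) (norm_nonneg c))

/-- Membership in `limitSubmodule`. -/
theorem mem_limitSubmodule_iff (v : ∀ k : ℕ, P.F k → A) :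
    v ∈ limitSubmodule P A ↔ IsCompat P A v ∧ ∃ C : ℝ, ∀ (k : ℕ) (a : P.F k), ‖v k a‖ ≤ C :=
  Iff.rfl

/-- Over a DVR with valuation norm (`W`), EVERY compatible system is bounded (by `1`): the bounded
part of the limit is the whole of `lim_k A[F k]` — `W[[Γ]] = lim_U W[Γ/U]` as printed, with no
boundedness condition. -/
theorem mem_limitSubmodule_iff_of_normDict {A : Type*} [NormedCommRing A] [IsDomain A]
    [IsDiscreteValuationRing A] {r : ℝ} (hd : T5MuInvariantDVR.NormDict A r)
    (v : ∀ k : ℕ, P.F k → A) : v ∈ limitSubmodule P A ↔ IsCompat P A v :=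
  ⟨fun h => h.1, fun h => ⟨h, 1, fun k a => hd.norm_le_one (v k a)⟩⟩

end Compat

section Limit

variable [CompactSpace X]

variable (X) in
/-- THE BOUNDED MEASURES: the bounded `A`-linear functionals on `C(X, A)`, as an `A`-submodule. -/
def boundedMeasures : Submodule A (C(X, A) →ₗ[A] A) where
  carrier := {m | ∃ C : ℝ, ∀ φ : C(X, A), ‖m φ‖ ≤ C * ‖φ‖}
  zero_mem' := ⟨0, fun φ => by simp⟩
  add_mem' := by
    rintro m₁ m₂ ⟨C, hC⟩ ⟨D, hD⟩
    refine ⟨C + D, fun φ => ?_⟩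
    rw [LinearMap.add_apply, add_mul]
    exact (norm_add_le _ _).trans (add_le_add (hC φ) (hD φ))
  smul_mem' := by
    rintro c m ⟨C, hC⟩
    refine ⟨‖c‖ * C, fun φ => ?_⟩
    rw [LinearMap.smul_apply, smul_eq_mul, mul_assoc]
    exact (norm_mul_le _ _).trans (mul_le_mul_of_nonneg_left (hC φ) (norm_nonneg c))

variable (X) in
/-- Membership in `boundedMeasures`. -/
theorem mem_boundedMeasures_iff (m : C(X, A) →ₗ[A] A) :
    m ∈ boundedMeasures X A ↔ ∃ C : ℝ, ∀ φ : C(X, A), ‖m φ‖ ≤ C * ‖φ‖ := Iff.rfl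

variable {A} in
/-- A bounded measure is bounded by a NON-NEGATIVE constant. -/
theorem exists_nonneg_bound_of_mem {m : C(X, A) →ₗ[A] A} (hm : m ∈ boundedMeasures X A) :
    ∃ C : ℝ, 0 ≤ C ∧ ∀ φ : C(X, A), ‖m φ‖ ≤ C * ‖φ‖ := by
  obtain ⟨C, hC⟩ := hm
  exact ⟨max C 0, le_max_right _ _, fun φ =>
    (hC φ).trans (mul_le_mul_of_nonneg_right (le_max_left _ _) (norm_nonneg φ))⟩

variable [NormOneClass A]

/-- The coordinates of a bounded measure lie in the bounded part of the limit. -/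
theorem coord_mem_limitSubmodule {m : C(X, A) →ₗ[A] A} (hm : m ∈ boundedMeasures X A) :
    P.coord m ∈ limitSubmodule P A := by
  obtain ⟨C, hC0, hC⟩ := exists_nonneg_bound_of_mem hm
  exact ⟨isCompat_coord m, C, P.norm_coord_le m hC0 hC⟩

/-- `m ↦ (coord m k)_k`, as an `A`-linear map from the bounded measures to the bounded part of
the limit. -/
noncomputable def coordLinear : boundedMeasures X A →ₗ[A] limitSubmodule P A where
  toFun m := ⟨P.coord m.1, coord_mem_limitSubmodule P A m.2⟩
  map_add' m₁ m₂ := by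
    ext k a
    simp only [Submodule.coe_add, Presentation.coord_apply, LinearMap.add_apply, Pi.add_apply]
  map_smul' c m := by
    ext k a
    simp only [Submodule.coe_smul, Presentation.coord_apply, LinearMap.smul_apply, Pi.smul_apply,
      RingHom.id_apply]

/-- `(coordLinear P A m).1 = P.coord m`. -/
@[simp] theorem coordLinear_apply_coe (m : boundedMeasures X A) :
    ((coordLinear P A m : limitSubmodule P A) : ∀ k : ℕ, P.F k → A) = P.coord m.1 := rfl

variable [T2Space X] [TotallyDisconnectedSpace X]

/-- `coordLinear` is injective: a bounded measure is its system of coordinates. -/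
theorem coordLinear_injective : Function.Injective (coordLinear P A) := by
  rintro ⟨m₁, hm₁⟩ ⟨m₂, hm₂⟩ h
  have h' : P.coord m₁ = P.coord m₂ := by
    have := congrArg Subtype.val h
    simpa using this
  obtain ⟨C₁, hC₁0, hC₁⟩ := exists_nonneg_bound_of_mem hm₁
  obtain ⟨C₂, hC₂0, hC₂⟩ := exists_nonneg_bound_of_mem hm₂
  refine Subtype.ext (P.eq_of_coord_eq m₁ m₂ (C := max C₁ C₂) (le_max_of_le_left hC₁0)
    (fun φ => (hC₁ φ).trans (mul_le_mul_of_nonneg_right (le_max_left _ _) (norm_nonneg φ)))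
    (fun φ => (hC₂ φ).trans (mul_le_mul_of_nonneg_right (le_max_right _ _) (norm_nonneg φ)))
    fun k a => ?_)
  exact congrFun (congrFun h' k) a

variable [IsUltrametricDist A] [CompleteSpace A] [Nonempty X]

omit [T2Space X] [TotallyDisconnectedSpace X] in
/-- `coordLinear` is surjective: every bounded compatible system is the system of coordinates of
a bounded measure (the Riemann-sum construction). -/
theorem coordLinear_surjective : Function.Surjective (coordLinear P A) := by
  rintro ⟨v, hv, C, hC⟩
  let d : Distribution P A := ⟨v, hv, C, hC⟩
  refine ⟨⟨ofDistribution P d, d.bound, norm_ofDistribution_le P d⟩, Subtype.ext ?_⟩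
  exact coord_ofDistribution_eq P d

/-- «`W[[Γ]] = lim_U W[Γ/U]`» IN THE MODEL, AS `A`-MODULES: the bounded `A`-valued measures on a
presented profinite space `X` are isomorphic, through their coordinates, to the bounded
compatible systems on the levels — for any complete ultrametric `A` (`W` included). -/
noncomputable def coordLinearEquiv : boundedMeasures X A ≃ₗ[A] limitSubmodule P A :=
  LinearEquiv.ofBijective (coordLinear P A) ⟨coordLinear_injective P A, coordLinear_surjective P A⟩

/-- `coordLinearEquiv` is `coordLinear` on the underlying map. -/
theorem coordLinearEquiv_apply (m : boundedMeasures X A) : coordLinearEquiv P A m = coordLinear P A m := rfl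

/-- The inverse of `coordLinearEquiv` sends a bounded compatible system to the Riemann-sum measure. -/
theorem coordLinearEquiv_symm_apply_coe (v : limitSubmodule P A) :
    ((coordLinearEquiv P A).symm v : C(X, A) →ₗ[A] A) =
      ofDistribution P ⟨v.1, v.2.1, v.2.2.choose, v.2.2.choose_spec⟩ := by
  have hmem : ofDistribution P ⟨v.1, v.2.1, v.2.2.choose, v.2.2.choose_spec⟩ ∈ boundedMeasures X A :=
    ⟨_, norm_ofDistribution_le P _⟩
  have h : (coordLinearEquiv P A).symm v = ⟨_, hmem⟩ := by
    apply (coordLinearEquiv P A).injective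
    rw [LinearEquiv.apply_symm_apply]
    apply Subtype.ext
    rw [coordLinearEquiv_apply, coordLinear_apply_coe]
    exact (coord_ofDistribution_eq P ⟨v.1, v.2.1, v.2.2.choose, v.2.2.choose_spec⟩).symm
  rw [h]

end Limit

end Summit.Ventures.HodgeRepro2.T5ProfiniteDistributionLimit
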